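import Literature.MathematicalPhysics.QuantumFieldTheory.Balaban1983to89.Node00.HistoryTermDatum214OlderReading

/-!
# BalabanUVNodes ∕ N10 ([B13], NODE A) → N22 (NE9): LEMMA 2's POTENTIALS READ ALONG A BANACH SECTION OF THE OLDER-TERM TABLE — the three history
# letters of this lane's `B13TermDatum214ParamHolo.h226T_of_inputs226Holo` along a section `cv : Pot → OlderTerms` (holomorphy `hVd`, measurability `hVm`)
# and module 102 §3's reading-section row `hcv`, from def-W1's (1.33)∕(1.41) READING LAW (`Node00.HistoryTermDatum214OlderReading`) + the UNSCALED-FIELD LAW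
# (`Node00.HistoryTermDatum214WindowDilated`) + three axioms of a Banach table reading (module 104)

Track A of `YM-PLAN.md` (cell `pub-ymgap`, HUMAN RULING D-0062), seat `pub-ymgap-dag-n10-c` g19, DAG edge **N10 → N22**, module 104 (sequel of modules 101∕102:
`…N10GenAnalyticReadingOfActivities` p663792, `…N10GenAnalyticReadingOfTermwise226`).  THEOREMS ONLY (0 `def`, 0 `sorry`, standard axioms);
`--supports stmt-QuantumFields-27364 --as helper`; COUNT-NEUTRAL.  Interface row IR-N22-AR, producer side, file 3.

WHY.  Module 102 §3 reduced N22's analytic reading of def-W1's term-data generator `(𝔇 K).Gn` to (i) NODE A's located (2.26) inputs per term, (ii) PER TERM the output of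
`h226T_of_inputs226Holo` ALONG A SECTION `cv : Pot → OlderTerms` — whose own inputs are three HISTORY LETTERS of Lemma 2's potentials along `cv`: `hVm` (measurable in the
row-bond field), `hVd` (complex differentiable in `p ∈ W`), `h220W` ((2.20) uniformly on `W`) — and (iii) the reading-section row `hcv` («`cv (ρ old)` reproduces the potentials of
an admissible `old`»).  def-W1 has since TYPED the law behind Lemma 2's potentials: storey 11 `UnscaledFieldLawOn χu χcu 𝒲 𝒪 γ` (`𝐕_k(Y; s, old, φ; B) = s⁻²·𝒲(φ; Y, sB) +
𝒪(old, φ; Y, sB)` on the real window) and storey 17 `ReadingAtoms` ∕ `ReadsBy 𝒪 R` ((1.33)∕(1.41): `𝒪` = a finite sum of integrals of bounded kernels × the older terms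
EVALUATED AT CONFIGURATIONS MOVING INSIDE THE TABLES — LINEAR in the history, seeing it ONLY ON THE TABLES).  THIS FILE derives `hcv`, `hVd` and `hVm` from those two
laws plus THREE AXIOMS of a Banach reading `(ρ, cv)` of the older-term table — (R1) the section reproduces an admissible history ON THE TABLES; (R2) `cv` is ℂ-LINEAR ON THE
TABLES and BOUNDED there (`‖cv p _j X ψ‖ ≤ C_v‖p‖`); (R3) every section `cv p` is ANALYTIC ON THE TABLES ([I] §1 p. 263's class) — satisfied by the normed space of bounded
analytic table germs with the restriction∕evaluation pair (the consumer's carrier; not constructed here).  What then remains displayed of module 37's inputs along `cv` is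
HISTORY-FREE: the Wilson part's measurability and its (2.20)-shape bound on the τ-region ([II] (2.20) for the quadratic form), and the τ-region's size.
* §1 (one reading `R : 𝔇.ReadingAtoms Z t S`, [folklore] over storey 17's faces): `integrable_atom_of_section` · ★ `isBoundedLinearMap_potential_section` — `p ↦ 𝒪_R(cv p, ξ; Y, A)` is
  a BOUNDED ℂ-LINEAR functional of `p` (`potential_add_old` ∕ `potential_smul_old` through `potential_congr_of_eqOn_tables` on (R2); bound by `norm_potential_le_of_sizeAdm` at
  `E₀ := C_v‖p‖`, `r₁ := 0`), hence ★ `differentiableOn_potential_section` (ANY set `U`); `measurable_potential_section` (storey 17's `measurable_potential_field_of_admHist` at the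
  admissible history `cv p`, (R3)); `potential_section_reading` ((R1) ⟹ `𝒪_R(cv (ρ old)) = 𝒪_R(old)`, storey 17's `potential_congr_of_eqOn_tables`).
* §2 (the datum's potentials `𝔇.𝒱` under `UnscaledFieldLawOn` + `ReadsBy`): ★★★ `𝒱_section_reading` (= module 102 §3's `hcv` row at one slice), ★★★ `differentiableOn_𝒱_section`
  (= module 37's `hVd` along `cv`, on ANY `W`), ★★★ `measurable_𝒱_section` (= module 37's `hVm` along `cv`, from the Wilson part's measurability `hWm`),
  ★★ `sum_norm_𝒱_section_le` (= module 37's `h220W` along `cv` on `‖p‖ ≤ R_p`, from a history-free (2.20)-shape bound for the Wilson part on the τ-region + the crude size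
  `norm_potential_section_le` of the read potential: `w := w₁ + τ_Σ·(Σ_j Σ_X C)·C_v·m·R_p`).
HONEST FRAMING (binding).  [folklore]-level calculus (bounded linear maps are differentiable; dominated-integral faces of storey 17 BY NAME) over def-W1's typed objects; the two
laws, the atoms' laws (`MapsToTables` ∕ `CfgContinuous` ∕ `CfgJointContinuous` ∕ `KernelBounded` ∕ `FiniteMass`) and (R1)–(R3) are DISPLAYED HYPOTHESES; (2.20) and the Wilson part are
untouched; NO estimate of Bałaban's ((1.36), (1.42)–(1.43), (2.20)) is proved or asserted; nothing of the record is constructed.  N10 ∕ N22 NOT discharged; K1⁹ ∕ K3⁸ NOT closed;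
counts UNMOVED (5∕27); nothing continuum ∕ ℝ⁴ ∕ OS ∕ mass-gap ∕ Clay.  References (TYPES only): [II] = Bałaban, CMP 116 (1988) Lemma 1 (1.33)–(1.36) p. 9, Lemma 2 (1.41)–(1.43)
p. 11, (2.14) p. 15, (2.20) p. 16; [I] = CMP 109 (1987) §1 p. 263, (2.9)–(2.13) pp. 266–268, (3.4) p. 270, (3.10) p. 272, (3.15)–(3.18) p. 273.
-/

noncomputable section

open Set Metric MeasureTheory
open scoped BigOperators Matrix

namespace YMDAG.N10

open Literature.MathematicalPhysics.QuantumFieldTheory.Balaban1983to89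
open Literature.MathematicalPhysics.QuantumFieldTheory.Balaban1983to89.TreeLengthTorus (TDom)
open Literature.MathematicalPhysics.QuantumFieldTheory.Balaban1983to89.Node00
open Literature.MathematicalPhysics.QuantumFieldTheory.Balaban1983to89.Node00.Sect2 (domSys domCount CPair)
open Literature.MathematicalPhysics.QuantumFieldTheory.Balaban1983to89.Node00.W1

variable {c₀ : B13.Consts} {P : Params} {𝔸 : Type} [NormedRing 𝔸] [NormedAlgebra ℂ 𝔸] {M k L : ℕ} [NeZero L]
  (𝔇 : TermDatum214 c₀ P 𝔸 M k L) {S : Type} [MeasurableSpace S] [TopologicalSpace S] [OpensMeasurableSpace S]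
  (sp : (j : ℕ) → (domSys P M j).Dom → Set (CPair P 𝔸))
  {Pot : Type*} [NormedAddCommGroup Pot] [NormedSpace ℂ Pot] (cv : Pot → OlderTerms P 𝔸 M k) {Cv : ℝ}

/-! ## §1 One reading `R : 𝔇.ReadingAtoms Z t S` along a Banach section of the older-term table -/
section OneReading

variable {𝔇} {Z : (domSys P M (k + 1)).Dom} {t : TermLabel P M k L} (R : 𝔇.ReadingAtoms Z t S)
  {W : Set (CPair P 𝔸)} {𝔅 : Set ((𝔇.𝒦 Z t).Λ → ℝ)} {C m : ℝ}

omit [NormedSpace ℂ Pot] in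
/-- (R3) + (R2-bound) ⟹ every section `cv p` is an ADMISSIBLE history of [I] §1 p. 263's class at size `E₀ := C_v‖p‖`, rate `r₁ := 0` (def-W1 `W1.AdmHist`). [folklore] -/
theorem section_mem_admHist (hCv : ∀ (p : Pot) (j : Fin (k + 1)) (X : (domSys P M j).Dom), ∀ ψ ∈ sp j X, ‖cv p j X ψ‖ ≤ Cv * ‖p‖)
    (han : ∀ (p : Pot) (j : Fin (k + 1)) (X : (domSys P M j).Dom), AnalyticOnNhd ℂ (cv p j X) (sp j X)) (p : Pot) :
    cv p ∈ AdmHist sp (Cv * ‖p‖) 0 k := by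
  refine ⟨fun j X ψ hψ => ?_, fun j X => han p j X⟩
  rw [zero_mul, neg_zero, Real.exp_zero, mul_one]
  exact hCv p j X ψ hψ

omit [NormedSpace ℂ Pot] in
/-- The atom integrand `s ↦ K(s)·(cv p)_j(X; cfg(ξ, A, s))` of a section is INTEGRABLE (bounded kernel × a table-analytic, hence continuous, function of a configuration moving
continuously inside the table; finite measure). [folklore] -/
theorem integrable_atom_of_section (hmaps : R.MapsToTables sp W 𝔅) (hcont : R.CfgContinuous) (hK : R.KernelBounded C) (hμ : R.FiniteMass m)
    (hCv : ∀ (p : Pot) (j : Fin (k + 1)) (X : (domSys P M j).Dom), ∀ ψ ∈ sp j X, ‖cv p j X ψ‖ ≤ Cv * ‖p‖)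
    (han : ∀ (p : Pot) (j : Fin (k + 1)) (X : (domSys P M j).Dom), AnalyticOnNhd ℂ (cv p j X) (sp j X))
    {ξ : CPair P 𝔸} (hξ : ξ ∈ W) {A : (𝔇.𝒦 Z t).Λ → ℝ} (hA : A ∈ 𝔅) (p : Pot) (Y : TDom P.d (L * domCount P M (k + 1))) (j : Fin (k + 1))
    (X : (domSys P M j).Dom) :
    Integrable (fun s => R.K Y j X s * cv p j X (R.cfg Y j X ξ A s)) (R.μ Y j X) := by
  obtain ⟨hKm, hKb⟩ := hK Y j X
  obtain ⟨hfin, -⟩ := hμ Y j X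
  haveI := hfin
  have hc : Continuous fun s : S => cv p j X (R.cfg Y j X ξ A s) :=
    continuous_iff_continuousAt.2 fun s =>
      ((han p j X) _ (hmaps Y j X ξ hξ A hA s)).continuousAt.comp (hcont Y j X ξ A).continuousAt
  refine Integrable.mono' (integrable_const (C * (Cv * ‖p‖))) (hKm.aestronglyMeasurable.mul hc.aestronglyMeasurable)
    (Filter.Eventually.of_forall fun s => ?_)
  rw [norm_mul]
  exact mul_le_mul (hKb s) (hCv p j X _ (hmaps Y j X ξ hξ A hA s)) (norm_nonneg _) ((norm_nonneg _).trans (hKb s))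

/-- ★ **THE READ POTENTIAL IS A BOUNDED ℂ-LINEAR FUNCTIONAL OF THE SECTION PARAMETER.**  Under the atoms' laws (`MapsToTables sp W 𝔅`, `CfgContinuous`, `KernelBounded C`,
`FiniteMass m`, `0 ≤ C`, `0 ≤ m`), (R2) — `cv` additive and ℂ-homogeneous ON THE TABLES, bounded there by `C_v‖p‖` (`0 ≤ C_v`) — and (R3), for `ξ ∈ W`, `A ∈ 𝔅`:
`p ↦ 𝒪_R(cv p, ξ; Y, A)` is a bounded linear map (storey 17: the reading is linear in the history and sees it only on the tables; crude size `Σ_j Σ_X C·(C_v‖p‖)·m`). [folklore] -/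
theorem isBoundedLinearMap_potential_section (hmaps : R.MapsToTables sp W 𝔅) (hcont : R.CfgContinuous) (hK : R.KernelBounded C) (hμ : R.FiniteMass m)
    (hC : 0 ≤ C) (hm : 0 ≤ m) (hCv0 : 0 ≤ Cv)
    (hadd : ∀ (p q : Pot) (j : Fin (k + 1)) (X : (domSys P M j).Dom), ∀ ψ ∈ sp j X, cv (p + q) j X ψ = cv p j X ψ + cv q j X ψ)
    (hsmul : ∀ (a : ℂ) (p : Pot) (j : Fin (k + 1)) (X : (domSys P M j).Dom), ∀ ψ ∈ sp j X, cv (a • p) j X ψ = a * cv p j X ψ)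
    (hCv : ∀ (p : Pot) (j : Fin (k + 1)) (X : (domSys P M j).Dom), ∀ ψ ∈ sp j X, ‖cv p j X ψ‖ ≤ Cv * ‖p‖)
    (han : ∀ (p : Pot) (j : Fin (k + 1)) (X : (domSys P M j).Dom), AnalyticOnNhd ℂ (cv p j X) (sp j X))
    {ξ : CPair P 𝔸} (hξ : ξ ∈ W) {A : (𝔇.𝒦 Z t).Λ → ℝ} (hA : A ∈ 𝔅) (Y : TDom P.d (L * domCount P M (k + 1))) :
    IsBoundedLinearMap ℂ (fun p => R.potential (cv p) ξ Y A) := by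
  have hint := fun p => integrable_atom_of_section sp cv R hmaps hcont hK hμ hCv han hξ hA p Y
  refine ⟨⟨fun p q => ?_, fun a p => ?_⟩, ?_⟩
  · -- additivity: `cv (p + q) = cv p + cv q` on the tables, then `potential_add_old`
    have hcongr : R.potential (cv (p + q)) ξ Y A = R.potential (cv p + cv q) ξ Y A :=
      R.potential_congr_of_eqOn_tables hmaps (fun j X ψ hψ => hadd p q j X ψ hψ) hξ Y hA
    rw [hcongr]
    exact R.potential_add_old (cv p) (cv q) ξ Y A (hint p) (hint q)
  · -- homogeneity: `cv (a • p) = a • cv p` on the tables, then `potential_smul_old`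
    have hcongr : R.potential (cv (a • p)) ξ Y A = R.potential (a • cv p) ξ Y A :=
      R.potential_congr_of_eqOn_tables hmaps (fun j X ψ hψ => hsmul a p j X ψ hψ) hξ Y hA
    rw [hcongr, R.potential_smul_old, smul_eq_mul]
  · -- bound: the crude (1.18)-size of the admissible history `cv p` (size `C_v‖p‖`, rate 0)
    refine ⟨(∑ _j : Fin (k + 1), ∑ _X : (domSys P M _j).Dom, C) * Cv * m + 1, by positivity, fun p => ?_⟩
    have hsize : cv p ∈ SizeAdm sp (Cv * ‖p‖) 0 k := (section_mem_admHist sp cv hCv han p).1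
    have h := R.norm_potential_le_of_sizeAdm hC (by positivity) hmaps hK hμ hsize hξ Y hA
    have e : ∀ (j : Fin (k + 1)) (X : (domSys P M j).Dom), C * (Cv * ‖p‖ * Real.exp (-(0 * (domSys P M j).dj X))) * m = C * Cv * m * ‖p‖ := by
      intro j X
      rw [zero_mul, neg_zero, Real.exp_zero, mul_one]
      ring
    simp_rw [e, ← Finset.sum_mul] at h
    have hp : 0 ≤ ‖p‖ := norm_nonneg p
    nlinarith [h, hp]

/-- ★ **HOLOMORPHY OF THE READ POTENTIAL IN THE SECTION PARAMETER**, on ANY set `U` (a bounded linear map is complex differentiable). [folklore] -/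
theorem differentiableOn_potential_section (hmaps : R.MapsToTables sp W 𝔅) (hcont : R.CfgContinuous) (hK : R.KernelBounded C) (hμ : R.FiniteMass m)
    (hC : 0 ≤ C) (hm : 0 ≤ m) (hCv0 : 0 ≤ Cv)
    (hadd : ∀ (p q : Pot) (j : Fin (k + 1)) (X : (domSys P M j).Dom), ∀ ψ ∈ sp j X, cv (p + q) j X ψ = cv p j X ψ + cv q j X ψ)
    (hsmul : ∀ (a : ℂ) (p : Pot) (j : Fin (k + 1)) (X : (domSys P M j).Dom), ∀ ψ ∈ sp j X, cv (a • p) j X ψ = a * cv p j X ψ)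
    (hCv : ∀ (p : Pot) (j : Fin (k + 1)) (X : (domSys P M j).Dom), ∀ ψ ∈ sp j X, ‖cv p j X ψ‖ ≤ Cv * ‖p‖)
    (han : ∀ (p : Pot) (j : Fin (k + 1)) (X : (domSys P M j).Dom), AnalyticOnNhd ℂ (cv p j X) (sp j X))
    {ξ : CPair P 𝔸} (hξ : ξ ∈ W) {A : (𝔇.𝒦 Z t).Λ → ℝ} (hA : A ∈ 𝔅) (Y : TDom P.d (L * domCount P M (k + 1))) (U : Set Pot) :
    DifferentiableOn ℂ (fun p => R.potential (cv p) ξ Y A) U :=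
  (isBoundedLinearMap_potential_section sp cv R hmaps hcont hK hμ hC hm hCv0 hadd hsmul hCv han hξ hA Y).differentiableOn

omit [NormedSpace ℂ Pot] in
/-- **MEASURABILITY OF THE READ POTENTIAL OF A SECTION IN THE FIELD** (clamped reading `𝔅 = univ`): storey 17's `measurable_potential_field_of_admHist` at the admissible history
`cv p` ((R3) + (R2-bound)). [folklore] -/
theorem measurable_potential_section (hmaps : R.MapsToTables sp W univ) (hjc : R.CfgJointContinuous) (hK : R.KernelBounded C) (hμ : R.FiniteMass m)
    (hCv : ∀ (p : Pot) (j : Fin (k + 1)) (X : (domSys P M j).Dom), ∀ ψ ∈ sp j X, ‖cv p j X ψ‖ ≤ Cv * ‖p‖)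
    (han : ∀ (p : Pot) (j : Fin (k + 1)) (X : (domSys P M j).Dom), AnalyticOnNhd ℂ (cv p j X) (sp j X))
    {ξ : CPair P 𝔸} (hξ : ξ ∈ W) (p : Pot) (Y : TDom P.d (L * domCount P M (k + 1))) :
    Measurable fun A : (𝔇.𝒦 Z t).Λ → ℝ => R.potential (cv p) ξ Y A :=
  R.measurable_potential_field_of_admHist hmaps hjc hK hμ (section_mem_admHist sp cv hCv han p) hξ Y

omit [NormedRing 𝔸] [NormedAlgebra ℂ 𝔸] [TopologicalSpace S] [OpensMeasurableSpace S] [NormedAddCommGroup Pot] [NormedSpace ℂ Pot] in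
/-- **THE SECTION REPRODUCES THE READ POTENTIAL OF THE HISTORY IT READS** ((R1): `cv q` agrees with `old` on the tables ⟹ `𝒪_R(cv q) = 𝒪_R(old)` at `ξ ∈ W`, `A ∈ 𝔅` —
storey 17's `potential_congr_of_eqOn_tables`: the reading sees the history only on the tables). [folklore] -/
theorem potential_section_reading (hmaps : R.MapsToTables sp W 𝔅) {q : Pot} {old : OlderTerms P 𝔸 M k}
    (hq : ∀ (j : Fin (k + 1)) (X : (domSys P M j).Dom), EqOn (cv q j X) (old j X) (sp j X))
    {ξ : CPair P 𝔸} (hξ : ξ ∈ W) (Y : TDom P.d (L * domCount P M (k + 1))) {A : (𝔇.𝒦 Z t).Λ → ℝ} (hA : A ∈ 𝔅) :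
    R.potential (cv q) ξ Y A = R.potential old ξ Y A :=
  R.potential_congr_of_eqOn_tables hmaps hq hξ Y hA

omit [TopologicalSpace S] [OpensMeasurableSpace S] [NormedSpace ℂ Pot] in
/-- **THE CRUDE SIZE OF THE READ POTENTIAL OF A SECTION** (field set `univ`): `‖𝒪_R(cv p, ξ; Y, A)‖ ≤ (Σ_j Σ_X C)·C_v·m·‖p‖` — storey 17's `norm_potential_le_of_sizeAdm` at the
size-admissible history `cv p` (size `C_v‖p‖`, rate 0). [folklore] -/
theorem norm_potential_section_le (hmaps : R.MapsToTables sp W univ) (hK : R.KernelBounded C) (hμ : R.FiniteMass m) (hC : 0 ≤ C) (hCv0 : 0 ≤ Cv)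
    (hCv : ∀ (p : Pot) (j : Fin (k + 1)) (X : (domSys P M j).Dom), ∀ ψ ∈ sp j X, ‖cv p j X ψ‖ ≤ Cv * ‖p‖)
    (han : ∀ (p : Pot) (j : Fin (k + 1)) (X : (domSys P M j).Dom), AnalyticOnNhd ℂ (cv p j X) (sp j X))
    {ξ : CPair P 𝔸} (hξ : ξ ∈ W) (p : Pot) (Y : TDom P.d (L * domCount P M (k + 1))) (A : (𝔇.𝒦 Z t).Λ → ℝ) :
    ‖R.potential (cv p) ξ Y A‖ ≤ (∑ _j : Fin (k + 1), ∑ _X : (domSys P M _j).Dom, C) * Cv * m * ‖p‖ := by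
  have hsize : cv p ∈ SizeAdm sp (Cv * ‖p‖) 0 k := (section_mem_admHist sp cv hCv han p).1
  have h := R.norm_potential_le_of_sizeAdm hC (by positivity) hmaps hK hμ hsize hξ Y (mem_univ A)
  have e : ∀ (j : Fin (k + 1)) (X : (domSys P M j).Dom), C * (Cv * ‖p‖ * Real.exp (-(0 * (domSys P M j).dj X))) * m = C * Cv * m * ‖p‖ := by
    intro j X
    rw [zero_mul, neg_zero, Real.exp_zero, mul_one]
    ring
  simp_rw [e, ← Finset.sum_mul] at h
  exact h

end OneReading

/-! ## §2 The datum's potentials `𝔇.𝒱` along the section, under the unscaled-field law (storey 11) and the reading law (storey 17) -/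
section Datum

variable {χu χcu : 𝔇.UnscaledChi} {𝒲 : 𝔇.UnscaledWilson} {𝒪 : 𝔇.UnscaledOlder} {γ : ℝ}
  (R : (Z : (domSys P M (k + 1)).Dom) → (t : TermLabel P M k L) → 𝔇.ReadingAtoms Z t S)
  (W : (Z : (domSys P M (k + 1)).Dom) → TermLabel P M k L → Set (CPair P 𝔸)) {C m : ℝ}

omit [NormedRing 𝔸] [NormedAlgebra ℂ 𝔸] [TopologicalSpace S] [OpensMeasurableSpace S] [NormedAddCommGroup Pot] [NormedSpace ℂ Pot] in
/-- ★★★ **MODULE 102 §3's READING-SECTION ROW `hcv` AT ONE SLICE, FROM THE LAWS.**  Under storey 11's unscaled-field law on `]0, γ]` and storey 17's reading law `ReadsBy 𝒪 R`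
with the atoms staying in the tables for configurations in the window `W Z t` and EVERY field (clamped reading): if the section `cv q` agrees with `old` on the tables ((R1) at
`q := ρ old`), then at every window coupling `s ∈ ]0, γ]`, `φ ∈ W Z t`, `Y`, `B`: **`𝔇.𝒱 Z t s (cv q) φ Y B = 𝔇.𝒱 Z t s old φ Y B`** — the Wilson part is history-free and the older part is
read on the tables. [folklore] -/
theorem 𝒱_section_reading (hlaw : 𝔇.UnscaledFieldLawOn χu χcu 𝒲 𝒪 γ) (hread : 𝔇.ReadsBy 𝒪 R)
    (hmaps : ∀ Z t, (R Z t).MapsToTables sp (W Z t) univ) {Z : (domSys P M (k + 1)).Dom} {t : TermLabel P M k L} {s : ℝ} (hs : s ∈ Ioc (0 : ℝ) γ)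
    {q : Pot} {old : OlderTerms P 𝔸 M k} (hq : ∀ (j : Fin (k + 1)) (X : (domSys P M j).Dom), EqOn (cv q j X) (old j X) (sp j X))
    {φ : CPair P 𝔸} (hφ : φ ∈ W Z t) (Y : TDom P.d (L * domCount P M (k + 1))) (B : (𝔇.𝒦 Z t).Λ → ℝ) :
    𝔇.𝒱 Z t ((s : ℝ) : ℂ) (cv q) φ Y B = 𝔇.𝒱 Z t ((s : ℝ) : ℂ) old φ Y B := by
  rw [TermDatum214.UnscaledFieldLawOn.𝒱_eq 𝔇 hlaw Z t hs, TermDatum214.UnscaledFieldLawOn.𝒱_eq 𝔇 hlaw Z t hs, hread Z t, hread Z t,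
    potential_section_reading sp cv (R Z t) (hmaps Z t) hq hφ Y (mem_univ _)]

/-- ★★★ **MODULE 37's `hVd` ALONG THE SECTION, FROM THE LAWS**: at a window coupling `s ∈ ]0, γ]`, `φ ∈ W Z t`, for every `Y`, `B` and ANY set `U`,
**`p ↦ 𝔇.𝒱 Z t s (cv p) φ Y B` is complex differentiable on `U`** — `s⁻²·𝒲(φ; Y, sB)` is constant in `p` and `𝒪(cv p, φ; Y, sB) = 𝒪_R(cv p, …)` is a bounded linear functional of `p`
(§1 under the atoms' laws, (R2), (R3)). [folklore] -/
theorem differentiableOn_𝒱_section (hlaw : 𝔇.UnscaledFieldLawOn χu χcu 𝒲 𝒪 γ) (hread : 𝔇.ReadsBy 𝒪 R)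
    (hmaps : ∀ Z t, (R Z t).MapsToTables sp (W Z t) univ) (hcont : ∀ Z t, (R Z t).CfgContinuous) (hK : ∀ Z t, (R Z t).KernelBounded C)
    (hμ : ∀ Z t, (R Z t).FiniteMass m) (hC : 0 ≤ C) (hm : 0 ≤ m) (hCv0 : 0 ≤ Cv)
    (hadd : ∀ (p q : Pot) (j : Fin (k + 1)) (X : (domSys P M j).Dom), ∀ ψ ∈ sp j X, cv (p + q) j X ψ = cv p j X ψ + cv q j X ψ)
    (hsmul : ∀ (a : ℂ) (p : Pot) (j : Fin (k + 1)) (X : (domSys P M j).Dom), ∀ ψ ∈ sp j X, cv (a • p) j X ψ = a * cv p j X ψ)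
    (hCv : ∀ (p : Pot) (j : Fin (k + 1)) (X : (domSys P M j).Dom), ∀ ψ ∈ sp j X, ‖cv p j X ψ‖ ≤ Cv * ‖p‖)
    (han : ∀ (p : Pot) (j : Fin (k + 1)) (X : (domSys P M j).Dom), AnalyticOnNhd ℂ (cv p j X) (sp j X))
    {Z : (domSys P M (k + 1)).Dom} {t : TermLabel P M k L} {s : ℝ} (hs : s ∈ Ioc (0 : ℝ) γ) {φ : CPair P 𝔸} (hφ : φ ∈ W Z t)
    (Y : TDom P.d (L * domCount P M (k + 1))) (B : (𝔇.𝒦 Z t).Λ → ℝ) (U : Set Pot) :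
    DifferentiableOn ℂ (fun p => 𝔇.𝒱 Z t ((s : ℝ) : ℂ) (cv p) φ Y B) U := by
  have hfun : (fun p => 𝔇.𝒱 Z t ((s : ℝ) : ℂ) (cv p) φ Y B) =
      fun p => ((((s : ℝ) : ℂ) ^ 2)⁻¹ * 𝒲 Z t φ Y (s • B)) + (R Z t).potential (cv p) φ Y (s • B) := by
    funext p
    rw [TermDatum214.UnscaledFieldLawOn.𝒱_eq 𝔇 hlaw Z t hs, hread Z t]
  rw [hfun]
  exact (differentiableOn_const _).add
    (differentiableOn_potential_section sp cv (R Z t) (hmaps Z t) (hcont Z t) (hK Z t) (hμ Z t) hC hm hCv0 hadd hsmul hCv han hφ (mem_univ _) Y U)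

omit [NormedSpace ℂ Pot] in
/-- ★★★ **MODULE 37's `hVm` ALONG THE SECTION, FROM THE LAWS + THE WILSON PART's MEASURABILITY**: at a window coupling `s ∈ ]0, γ]`, `φ ∈ W Z t`, for every section parameter `p`
and domain `Y`, **`B ↦ 𝔇.𝒱 Z t s (cv p) φ Y B` is measurable** — the Wilson part `B ↦ 𝒲(φ; Y, sB)` by hypothesis (`hWm`, history-free), the older part by storey 17's field
measurability of the read potential at the admissible history `cv p` (atoms jointly continuous in (field, parameter), clamped reading). [folklore] -/
theorem measurable_𝒱_section (hlaw : 𝔇.UnscaledFieldLawOn χu χcu 𝒲 𝒪 γ) (hread : 𝔇.ReadsBy 𝒪 R)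
    (hmaps : ∀ Z t, (R Z t).MapsToTables sp (W Z t) univ) (hjc : ∀ Z t, (R Z t).CfgJointContinuous) (hK : ∀ Z t, (R Z t).KernelBounded C)
    (hμ : ∀ Z t, (R Z t).FiniteMass m)
    (hCv : ∀ (p : Pot) (j : Fin (k + 1)) (X : (domSys P M j).Dom), ∀ ψ ∈ sp j X, ‖cv p j X ψ‖ ≤ Cv * ‖p‖)
    (han : ∀ (p : Pot) (j : Fin (k + 1)) (X : (domSys P M j).Dom), AnalyticOnNhd ℂ (cv p j X) (sp j X))
    (hWm : ∀ (Z : (domSys P M (k + 1)).Dom) (t : TermLabel P M k L) (φ : CPair P 𝔸) (Y : TDom P.d (L * domCount P M (k + 1))),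
      Measurable fun B : (𝔇.𝒦 Z t).Λ → ℝ => 𝒲 Z t φ Y B)
    {Z : (domSys P M (k + 1)).Dom} {t : TermLabel P M k L} {s : ℝ} (hs : s ∈ Ioc (0 : ℝ) γ) {φ : CPair P 𝔸} (hφ : φ ∈ W Z t) (p : Pot)
    (Y : TDom P.d (L * domCount P M (k + 1))) :
    Measurable (𝔇.𝒱 Z t ((s : ℝ) : ℂ) (cv p) φ Y) := by
  have hfun : 𝔇.𝒱 Z t ((s : ℝ) : ℂ) (cv p) φ Y =
      fun B => ((((s : ℝ) : ℂ) ^ 2)⁻¹ * 𝒲 Z t φ Y (s • B)) + (R Z t).potential (cv p) φ Y (s • B) := by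
    funext B
    rw [TermDatum214.UnscaledFieldLawOn.𝒱_eq 𝔇 hlaw Z t hs, hread Z t]
  rw [hfun]
  have hsm : Measurable fun B : (𝔇.𝒦 Z t).Λ → ℝ => s • B := (continuous_const_smul s).measurable
  exact (((hWm Z t φ Y).comp hsm).const_mul _).add
    ((measurable_potential_section sp cv (R Z t) (hmaps Z t) (hjc Z t) (hK Z t) (hμ Z t) hCv han hφ p Y).comp hsm)

omit [TopologicalSpace S] [OpensMeasurableSpace S] [NormedSpace ℂ Pot] in
/-- ★★ **MODULE 37's `h220W` ALONG THE SECTION, FROM A HISTORY-FREE (2.20) FOR THE WILSON PART + THE CRUDE SIZE OF THE READ POTENTIAL.**  At a window coupling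
`s ∈ ]0, γ]`, `φ ∈ W Z t`: IF the Wilson part obeys a (2.20)-shape bound on the τ-region — `Σ_{Y ∈ 𝐃} ‖τ(Y)‖·‖s⁻²·𝒲(φ; Y, sB)‖ ≤ ½a₂₀·(B·B) + w₁` for `τ(Y) ∈ Uτ Y`
(history-free; [II] (2.20) p. 16 for the quadratic-form part) — and the τ-region has `Σ_{Y ∈ 𝐃} ‖τ(Y)‖ ≤ τ_Σ`, THEN for every section parameter `‖p‖ ≤ R_p`:
**`Σ_{Y ∈ 𝐃} ‖τ(Y)‖·‖𝐕_k(Y; s, cv p, φ; B)‖ ≤ ½a₂₀·(B·B) + (w₁ + τ_Σ·(Σ_j Σ_X C)·C_v·m·R_p)`** — i.e. `h226T_of_inputs226Holo`'s `h220W` with the record's `w := w₁ + τ_Σ·M·R_p`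
(the older-terms part is bounded uniformly in the field by the crude size of the section). [folklore] -/
theorem sum_norm_𝒱_section_le (hlaw : 𝔇.UnscaledFieldLawOn χu χcu 𝒲 𝒪 γ) (hread : 𝔇.ReadsBy 𝒪 R)
    (hmaps : ∀ Z t, (R Z t).MapsToTables sp (W Z t) univ) (hK : ∀ Z t, (R Z t).KernelBounded C) (hμ : ∀ Z t, (R Z t).FiniteMass m)
    (hC : 0 ≤ C) (hm : 0 ≤ m) (hCv0 : 0 ≤ Cv)
    (hCv : ∀ (p : Pot) (j : Fin (k + 1)) (X : (domSys P M j).Dom), ∀ ψ ∈ sp j X, ‖cv p j X ψ‖ ≤ Cv * ‖p‖)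
    (han : ∀ (p : Pot) (j : Fin (k + 1)) (X : (domSys P M j).Dom), AnalyticOnNhd ℂ (cv p j X) (sp j X))
    {Z : (domSys P M (k + 1)).Dom} {t : TermLabel P M k L} {s : ℝ} (hs : s ∈ Ioc (0 : ℝ) γ) {φ : CPair P 𝔸} (hφ : φ ∈ W Z t)
    {Uτ : TDom P.d (L * domCount P M (k + 1)) → Set ℂ} {τs a₂₀ w₁ Rp : ℝ} (hRp : 0 ≤ Rp)
    (hτ : ∀ τ : TDom P.d (L * domCount P M (k + 1)) → ℂ, (∀ Y, τ Y ∈ Uτ Y) → ∑ Y ∈ t.1, ‖τ Y‖ ≤ τs)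
    (hW220 : ∀ τ : TDom P.d (L * domCount P M (k + 1)) → ℂ, (∀ Y, τ Y ∈ Uτ Y) → ∀ B : (𝔇.𝒦 Z t).Λ → ℝ,
      ∑ Y ∈ t.1, ‖τ Y‖ * ‖(((s : ℝ) : ℂ) ^ 2)⁻¹ * 𝒲 Z t φ Y (s • B)‖ ≤ a₂₀ / 2 * (B ⬝ᵥ B) + w₁)
    {p : Pot} (hp : ‖p‖ ≤ Rp) (τ : TDom P.d (L * domCount P M (k + 1)) → ℂ) (hτU : ∀ Y, τ Y ∈ Uτ Y) (B : (𝔇.𝒦 Z t).Λ → ℝ) :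
    ∑ Y ∈ t.1, ‖τ Y‖ * ‖𝔇.𝒱 Z t ((s : ℝ) : ℂ) (cv p) φ Y B‖ ≤
      a₂₀ / 2 * (B ⬝ᵥ B) + (w₁ + τs * ((∑ _j : Fin (k + 1), ∑ _X : (domSys P M _j).Dom, C) * Cv * m * Rp)) := by
  set Mt : ℝ := (∑ _j : Fin (k + 1), ∑ _X : (domSys P M _j).Dom, C) * Cv * m with hMt
  have hMt0 : 0 ≤ Mt := by positivity
  -- per domain: `‖𝐕‖ ≤ ‖Wilson‖ + M·R_p`
  have hY : ∀ Y, ‖𝔇.𝒱 Z t ((s : ℝ) : ℂ) (cv p) φ Y B‖ ≤ ‖(((s : ℝ) : ℂ) ^ 2)⁻¹ * 𝒲 Z t φ Y (s • B)‖ + Mt * Rp := by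
    intro Y
    rw [TermDatum214.UnscaledFieldLawOn.𝒱_eq 𝔇 hlaw Z t hs, hread Z t]
    refine (norm_add_le _ _).trans (add_le_add le_rfl ?_)
    exact (norm_potential_section_le sp cv (R Z t) (hmaps Z t) (hK Z t) (hμ Z t) hC hCv0 hCv han hφ p Y (s • B)).trans
      (mul_le_mul_of_nonneg_left hp hMt0)
  calc ∑ Y ∈ t.1, ‖τ Y‖ * ‖𝔇.𝒱 Z t ((s : ℝ) : ℂ) (cv p) φ Y B‖
      ≤ ∑ Y ∈ t.1, (‖τ Y‖ * ‖(((s : ℝ) : ℂ) ^ 2)⁻¹ * 𝒲 Z t φ Y (s • B)‖ + ‖τ Y‖ * (Mt * Rp)) :=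
        Finset.sum_le_sum fun Y _ => by rw [← mul_add]; exact mul_le_mul_of_nonneg_left (hY Y) (norm_nonneg _)
    _ = ∑ Y ∈ t.1, ‖τ Y‖ * ‖(((s : ℝ) : ℂ) ^ 2)⁻¹ * 𝒲 Z t φ Y (s • B)‖ + (∑ Y ∈ t.1, ‖τ Y‖) * (Mt * Rp) := by
        rw [Finset.sum_add_distrib, Finset.sum_mul]
    _ ≤ (a₂₀ / 2 * (B ⬝ᵥ B) + w₁) + τs * (Mt * Rp) :=
        add_le_add (hW220 τ hτU B) (mul_le_mul_of_nonneg_right (hτ τ hτU) (mul_nonneg hMt0 hRp))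
    _ = a₂₀ / 2 * (B ⬝ᵥ B) + (w₁ + τs * (Mt * Rp)) := by ring
    _ = _ := by rw [hMt]

end Datum

end YMDAG.N10

end
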